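import Mathlib
import Literature.Probability.LatticeModels.GKSInequalities
import Summits.CriticalPhenomena.Ising3DConformalLimit.Theorems.PrecisionLaplacianInverseMFerromagnetEntryNonposOfPcov
import HarnessLib

/-!
# Crux `PrecisionLaplacian.MoebiusLimitOfTwoPointLaw` (stmt-CriticalPhenomena-4801), line `Sketch` —
# tooth `stub_amputatedLebowitz_of_triangle_limit` (removing the ghost triangle by continuity)

THEOREM-ONLY file (no definitions).  Let `Σ_t = (⟨σ_pσ_q⟩_t)` and `⟨·⟩_t` be the second-moment
matrix and the expectation of the zero-field pair system `gksExpect univ K C` ENLARGED by the three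
bonds `{x₃,x₄}, {x₂,x₄}, {x₂,x₃}` of common coupling `t` (bond index type `Fin (m + 3)`, via
`Fin.append`), and let
`F t = ∑ₐ (Σ_t⁻¹)_{z a} (⟨σ_aσ₂⟩_t⟨σ₃σ₄⟩_t + ⟨σ_aσ₃⟩_t⟨σ₂σ₄⟩_t + ⟨σ_aσ₄⟩_t⟨σ₂σ₃⟩_t − ⟨σ_aσ₂σ₃σ₄⟩_t)`
be the amputated-Lebowitz charge of the enlarged system.  If for every `ε > 0` some `t ∈ [0, ε]`
has `F t ≥ 0`, then the charge of the ORIGINAL system is `≥ 0`.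

Proof.  (1) `t ↦ F t` is continuous: every `gksExpect` is a quotient of finite sums of
exponentials of affine functions of the coupling vector (denominator `> 0`, `gksSum_one_pos`), the
coupling vector `Fin.append K (fun _ => t)` is continuous in `t`, and `Σ_t` is positive definite for
every `t` (`schur_posDef`, no sign hypothesis), so `t ↦ Σ_t⁻¹` is continuous
(`continuousAt_matrix_inv`).  (2) The hypothesis says `0 ≤ F t` frequently near `t = 0`, hence
`0 ≤ F 0` (`IsClosed.mem_of_frequently_of_tendsto`).  (3) At `t = 0` the appended bonds contribute
`0 · ω_T` to the Hamiltonian (`Fin.sum_univ_add`), so every `⟨·⟩_0` is the original expectation and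
`F 0` is the original charge.
-/

namespace Summit.CriticalPhenomena.Ising3DConformalLimit.PrecisionLaplacianMoebiusLimitOfTwoPointLaw

open Literature.Probability.LatticeModels Finset Matrix Filter Topology
open Summit.CriticalPhenomena.Ising3DConformalLimit.Cruxes.InverseMFerromagnet.PartialCovarianceLadder
  (schur_posDef)

/-! ## Continuity of the spin system in the coupling vector -/

section Couplings

variable {Λ : Type*} [Fintype Λ] [DecidableEq Λ] {ι : Type*}

-- adapted from Literature/Barriers/CriticalPhenomena/LongRangeTrivialityOnZ3TorusLimit.lean
-- (`continuous_gksSum`, `continuous_gksExpect`; not imported to keep the import closure small)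
/-- The unnormalised expectation `Z⟨f⟩_{Λ;K}` is continuous in the coupling vector `K` (a finite
sum of exponentials of linear forms in `K`). [folklore] -/
theorem ampLebTL_continuous_gksSum (s : Finset ι) (C : ι → Finset Λ) (f : SpinConfig Λ → ℝ) :
    Continuous fun K : ι → ℝ => gksSum s K C f := by
  unfold gksSum gksWeight gksHamiltonian
  refine continuous_finsetSum _ fun ω _ => continuous_const.fun_mul (Real.continuous_exp.comp' ?_)
  exact continuous_finsetSum _ fun i _ => (continuous_apply i).fun_mul continuous_const

/-- The expectation `⟨f⟩_{Λ;K}` is continuous in the coupling vector `K`. [folklore] -/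
theorem ampLebTL_continuous_gksExpect (s : Finset ι) (C : ι → Finset Λ) (f : SpinConfig Λ → ℝ) :
    Continuous fun K : ι → ℝ => gksExpect s K C f := by
  unfold gksExpect
  exact (ampLebTL_continuous_gksSum s C f).div₀ (ampLebTL_continuous_gksSum s C fun _ => 1)
    fun K => (gksSum_one_pos s K C).ne'

end Couplings

/-- The entries of the inverse of the second-moment matrix `Σ_K = (⟨σ_pσ_q⟩_K)` are continuous in
the coupling vector `K`: `Σ_K` is continuous in `K` and positive definite for every `K`
(`schur_posDef`), so matrix inversion is continuous at each `Σ_K`. [folklore] -/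
theorem ampLebTL_continuous_inv_entry {n m : ℕ} (C : Fin m → Finset (Fin n)) (z a : Fin n) :
    Continuous fun K : Fin m → ℝ => (Matrix.of fun p q : Fin n =>
      gksExpect Finset.univ K C (fun ω => spinAt p ω * spinAt q ω))⁻¹ z a := by
  have hS : Continuous fun K : Fin m → ℝ => (Matrix.of fun p q : Fin n =>
      gksExpect Finset.univ K C (fun ω => spinAt p ω * spinAt q ω)) :=
    continuous_matrix fun p q => ampLebTL_continuous_gksExpect Finset.univ C _
  have hinv : Continuous fun K : Fin m → ℝ => (Matrix.of fun p q : Fin n =>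
      gksExpect Finset.univ K C (fun ω => spinAt p ω * spinAt q ω))⁻¹ :=
    continuous_iff_continuousAt.2 fun K => (continuousAt_matrix_inv _ (by
      rw [Ring.inverse_eq_inv']
      exact continuousAt_inv₀ (schur_posDef n m K C).det_pos.ne')).comp' hS.continuousAt
  exact hinv.matrix_elem z a

/-! ## Appending bonds of a common coupling `t` -/

/-- The coupling vector `Fin.append K (fun _ => t)` (old couplings `K`, `k` new bonds of common
coupling `t`) is continuous in `t`. [folklore] -/
theorem ampLebTL_continuous_append {m k : ℕ} (K : Fin m → ℝ) :
    Continuous fun t : ℝ => Fin.append K (fun _ : Fin k => t) := by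
  refine continuous_pi fun i => ?_
  induction i using Fin.addCases with
  | left j => simp only [Fin.append_left]; exact continuous_const
  | right j => simp only [Fin.append_right]; exact continuous_id

/-- Every expectation of the enlarged system is continuous in the common coupling `t` of the
appended bonds. [folklore] -/
theorem ampLebTL_continuous_gksExpect_append {n m k : ℕ} (K : Fin m → ℝ)
    (C : Fin m → Finset (Fin n)) (T : Fin k → Finset (Fin n)) (f : SpinConfig (Fin n) → ℝ) :
    Continuous fun t : ℝ =>
      gksExpect Finset.univ (Fin.append K (fun _ : Fin k => t)) (Fin.append C T) f :=
  (ampLebTL_continuous_gksExpect Finset.univ (Fin.append C T) f).comp' (ampLebTL_continuous_append K)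

/-- Every entry of the inverse second-moment matrix of the enlarged system is continuous in the
common coupling `t` of the appended bonds. [folklore] -/
theorem ampLebTL_continuous_inv_entry_append {n m k : ℕ} (K : Fin m → ℝ)
    (C : Fin m → Finset (Fin n)) (T : Fin k → Finset (Fin n)) (z a : Fin n) :
    Continuous fun t : ℝ => (Matrix.of fun p q : Fin n =>
      gksExpect Finset.univ (Fin.append K (fun _ : Fin k => t)) (Fin.append C T)
        (fun ω => spinAt p ω * spinAt q ω))⁻¹ z a :=
  (ampLebTL_continuous_inv_entry (Fin.append C T) z a).comp' (ampLebTL_continuous_append K)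

/-- At common coupling `t = 0` the appended bonds do not change any expectation: the Hamiltonians
agree (`Fin.sum_univ_add`; the new summands are `0 · ω_{T j}`). [folklore] -/
theorem ampLebTL_gksExpect_append_zero {n m k : ℕ} (K : Fin m → ℝ) (C : Fin m → Finset (Fin n))
    (T : Fin k → Finset (Fin n)) (f : SpinConfig (Fin n) → ℝ) :
    gksExpect Finset.univ (Fin.append K (fun _ : Fin k => (0 : ℝ))) (Fin.append C T) f
      = gksExpect Finset.univ K C f := by
  simp only [gksExpect, gksSum, gksWeight, gksHamiltonian, Fin.sum_univ_add, Fin.append_left,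
    Fin.append_right, zero_mul, Finset.sum_const_zero, add_zero]

/-! ## A limit lemma on `ℝ` -/

/-- If `F` is continuous at `0` and every interval `[0, ε]`, `ε > 0`, contains a point where
`F ≥ 0`, then `F 0 ≥ 0` (`0 ≤ F` holds frequently at `𝓝 0` and `[0, ∞)` is closed). [folklore] -/
theorem ampLebTL_nonneg_at_zero {F : ℝ → ℝ}
    (h : ∀ ε : ℝ, 0 < ε → ∃ t : ℝ, 0 ≤ t ∧ t ≤ ε ∧ 0 ≤ F t) (hc : ContinuousAt F 0) : 0 ≤ F 0 := by
  have hfreq : ∃ᶠ t in 𝓝 (0 : ℝ), 0 ≤ F t := by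
    rw [Filter.frequently_iff]
    intro U hU
    obtain ⟨ε, hε, hball⟩ := Metric.mem_nhds_iff.1 hU
    obtain ⟨t, ht0, htε, hFt⟩ := h (ε / 2) (half_pos hε)
    refine ⟨t, hball ?_, hFt⟩
    rw [Metric.mem_ball, Real.dist_eq, sub_zero, abs_of_nonneg ht0]
    linarith
  exact ge_of_tendsto_of_frequently hc.tendsto hfreq

/-! ## The stub -/

/-- **Tooth `stub_amputatedLebowitz_of_triangle_limit` (removing the ghost triangle by
continuity).**  If for every `ε > 0` the amputated-Lebowitz charge
`∑ₐ (Σ⁻¹)_{z a}(⟨σ_aσ₂⟩⟨σ₃σ₄⟩ + ⟨σ_aσ₃⟩⟨σ₂σ₄⟩ + ⟨σ_aσ₄⟩⟨σ₂σ₃⟩ − ⟨σ_aσ₂σ₃σ₄⟩)` of the system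
enlarged by the triangle `{x₃,x₄}, {x₂,x₄}, {x₂,x₃}` of some common coupling `t ∈ [0, ε]` is
`≥ 0`, then the charge of the original zero-field pair system `gksExpect univ K C` is `≥ 0`:
the charge of the enlarged system is continuous in `t` (finite sums of exponentials; `Σ_t`
positive definite, `schur_posDef`), `≥ 0` frequently near `t = 0`, hence `≥ 0` at `t = 0`, where
the enlarged system is the original one. [folklore] -/
theorem stub_amputatedLebowitz_of_triangle_limit :
    ∀ (n m : ℕ) (K : Fin m → ℝ) (C : Fin m → Finset (Fin n)) (z x₂ x₃ x₄ : Fin n),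
      (∀ ε : ℝ, 0 < ε → ∃ t : ℝ, 0 ≤ t ∧ t ≤ ε ∧
        0 ≤ ∑ a : Fin n,
          (Matrix.of fun (p q : Fin n) =>
              gksExpect Finset.univ (Fin.append K (fun _ : Fin 3 => t))
                (Fin.append C ![{x₃, x₄}, {x₂, x₄}, {x₂, x₃}]) (fun ω => spinAt p ω * spinAt q ω))⁻¹ z a *
            (gksExpect Finset.univ (Fin.append K (fun _ : Fin 3 => t))
                  (Fin.append C ![{x₃, x₄}, {x₂, x₄}, {x₂, x₃}]) (fun ω => spinAt a ω * spinAt x₂ ω) *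
                gksExpect Finset.univ (Fin.append K (fun _ : Fin 3 => t))
                  (Fin.append C ![{x₃, x₄}, {x₂, x₄}, {x₂, x₃}]) (fun ω => spinAt x₃ ω * spinAt x₄ ω) +
              gksExpect Finset.univ (Fin.append K (fun _ : Fin 3 => t))
                  (Fin.append C ![{x₃, x₄}, {x₂, x₄}, {x₂, x₃}]) (fun ω => spinAt a ω * spinAt x₃ ω) *
                gksExpect Finset.univ (Fin.append K (fun _ : Fin 3 => t))
                  (Fin.append C ![{x₃, x₄}, {x₂, x₄}, {x₂, x₃}]) (fun ω => spinAt x₂ ω * spinAt x₄ ω) +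
              gksExpect Finset.univ (Fin.append K (fun _ : Fin 3 => t))
                  (Fin.append C ![{x₃, x₄}, {x₂, x₄}, {x₂, x₃}]) (fun ω => spinAt a ω * spinAt x₄ ω) *
                gksExpect Finset.univ (Fin.append K (fun _ : Fin 3 => t))
                  (Fin.append C ![{x₃, x₄}, {x₂, x₄}, {x₂, x₃}]) (fun ω => spinAt x₂ ω * spinAt x₃ ω) -
              gksExpect Finset.univ (Fin.append K (fun _ : Fin 3 => t))
                  (Fin.append C ![{x₃, x₄}, {x₂, x₄}, {x₂, x₃}])
                (fun ω => spinAt a ω * spinAt x₂ ω * spinAt x₃ ω * spinAt x₄ ω))) →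
      0 ≤ ∑ a : Fin n,
          (Matrix.of fun (p q : Fin n) =>
              gksExpect Finset.univ K C (fun ω => spinAt p ω * spinAt q ω))⁻¹ z a *
            (gksExpect Finset.univ K C (fun ω => spinAt a ω * spinAt x₂ ω) *
                gksExpect Finset.univ K C (fun ω => spinAt x₃ ω * spinAt x₄ ω) +
              gksExpect Finset.univ K C (fun ω => spinAt a ω * spinAt x₃ ω) *
                gksExpect Finset.univ K C (fun ω => spinAt x₂ ω * spinAt x₄ ω) +
              gksExpect Finset.univ K C (fun ω => spinAt a ω * spinAt x₄ ω) *
                gksExpect Finset.univ K C (fun ω => spinAt x₂ ω * spinAt x₃ ω) -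
              gksExpect Finset.univ K C
                (fun ω => spinAt a ω * spinAt x₂ ω * spinAt x₃ ω * spinAt x₄ ω)) := by
  intro n m K C z x₂ x₃ x₄ h
  -- `0 ≤ F 0` for the charge `F` of the enlarged system (read off from `h` by unification)
  have key := ampLebTL_nonneg_at_zero h ?hc
  case hc =>
    -- continuity of the charge of the enlarged system in the common coupling `t`
    refine Continuous.continuousAt ?_
    refine continuous_finsetSum _ fun a _ => ?_
    refine Continuous.fun_mul (ampLebTL_continuous_inv_entry_append K C _ z a) ?_
    refine Continuous.fun_sub ?_ (ampLebTL_continuous_gksExpect_append K C _ _)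
    refine Continuous.fun_add (Continuous.fun_add ?_ ?_) ?_ <;>
      exact (ampLebTL_continuous_gksExpect_append K C _ _).fun_mul
        (ampLebTL_continuous_gksExpect_append K C _ _)
  -- at `t = 0` the enlarged system is the original one
  simpa only [ampLebTL_gksExpect_append_zero] using key

end Summit.CriticalPhenomena.Ising3DConformalLimit.PrecisionLaplacianMoebiusLimitOfTwoPointLaw
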